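import Mathlib
import HarnessLib
import Summits.HubbardSuperconductivity.HubbardSuperconductivity.Theorems.KLProgrammeKLRegimeEngineTowerLevNumericsPins
import Literature.MathematicalPhysics.QuantumLattice.GrassmannEffectiveActionBound

/-!
# Route `KLProgramme` — crux K3 ENGINE (stmt-HubbardSuperconductivity-20437 `KLRegimeEngineV17F2`), stub (b) v2, THE LEVELS PACKAGE (ℓ), numerics side
# «(ℓ)-NUMERICS» part 3a (cell gate-hubbard-kl, seat p4 g21): THE BASE DATUM ON SHAPES AND THE FIELD-WEIGHTED NORM WITH TWO DEGREES

Two model-free reductions used by the numerics package of the ∀j-assembly (`kernelNormsLevels_all_klEng_sharp`):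
* `levNum_normV_le_two` — the field-weighted norm `normV Γ κ ρ N` of a profile supported on degrees `1, 2` is at most `(e²(κ+ρ))²·N 1 + (e²(κ+ρ))⁴·N 2`
  (the assembly's `nV` binder has exactly this profile: `N 1 = (|β|/(4M))·Σ_z‖framePosKernel K_n z‖(1+|z|)`, `N 2 = |U|·|β|/(4M)`);
* **`levNum_base_reduce`** — on the SHAPES `κ = κ₀`, `ρ = ρ₀`, `αw = a₀·(M/β)`, `crw = r₀·(M/β)`, `ccw = w₀·(M/β)`, the frame weight `F ≤ f₀·U` and the θ-door
  `U ≤ 1/(2θ₁+1)` (`θ₁ = (e·a₀/(4κ₀²))·((e²(κ₀+ρ₀))²·f₀ + (e²(κ₀+ρ₀))⁴)`), the assembly's derived base binders satisfy `e·αw·nV/κ² ≤ 1/2` (its `hθ` row with room),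
  `cg = g₀`, `Ag = A₀·(β/M)`, `P₀·(M/β)² ≤ Pg ≤ 2P₀·(M/β)²` with `g₀ = e·a₀·(e²(κ₀+ρ₀))⁴/(4κ₀²)`, `A₀ = e·r₀·(e²(κ₀+ρ₀))⁴/(4w₀g₀²)`, `P₀ = w₀²g₀/ρ₀²`
  — the inputs of …TowerLevNumericsBounds/Doors.
Pure real arithmetic; nothing about the model is asserted; nothing asserts (ℓ), any stub, K3 or superconductivity.
References: BGM 2006 §2.8 (2.77)–(2.80), (2.93)–(2.98) [cite: BenfattoGiulianiMastropietro2006].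
-/

noncomputable section

namespace Summit.HubbardSuperconductivity.HubbardSuperconductivity.Theorems.EngineV8

set_option linter.dupNamespace false -- summit = problem name (single-conjunct summit), D-0017

open Real Finset Literature.MathematicalPhysics.QuantumLattice

/-! ## §1 The field-weighted norm of a two-degree profile -/

/-- **`normV` of a profile supported on degrees `1` and `2`**: if `N ≥ 0` vanishes off `{1, 2}` then
`normV Γ κ ρ N ≤ (e²(κ+ρ))²·N 1 + (e²(κ+ρ))⁴·N 2` (`κ, ρ ≥ 0`). [cite: BenfattoGiulianiMastropietro2006, (2.77)-(2.80)] -/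
theorem levNum_normV_le_two {Γ : Type*} [Fintype Γ] {κ ρ : ℝ} (hκ : 0 ≤ κ) (hρ : 0 ≤ ρ) (N : ℕ → ℝ) (hN : ∀ m, 0 ≤ N m)
    (hN0 : ∀ m, m ≠ 1 → m ≠ 2 → N m = 0) :
    normV Γ κ ρ N ≤ (exp 2 * (κ + ρ)) ^ 2 * N 1 + (exp 2 * (κ + ρ)) ^ 4 * N 2 := by
  unfold normV
  set f : ℕ → ℝ := fun m' => (exp 2 * (κ + ρ)) ^ (2 * m') * N m' with hf
  have hf0 : ∀ m, 0 ≤ f m := fun m => mul_nonneg (by positivity) (hN m)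
  have hfz : ∀ m, m ≠ 1 → m ≠ 2 → f m = 0 := fun m h1 h2 => by simp only [hf, hN0 m h1 h2, mul_zero]
  have hsub : (range (Fintype.card Γ / 2 + 1)).filter (fun m => m = 1 ∨ m = 2) ⊆ ({1, 2} : Finset ℕ) := by
    intro m hm
    rw [mem_filter] at hm
    rcases hm.2 with h | h <;> simp [h]
  calc ∑ m' ∈ range (Fintype.card Γ / 2 + 1), (exp 2 * (κ + ρ)) ^ (2 * m') * N m'
      = ∑ m' ∈ range (Fintype.card Γ / 2 + 1), f m' := rfl
    _ = ∑ m' ∈ (range (Fintype.card Γ / 2 + 1)).filter (fun m => m = 1 ∨ m = 2), f m' := by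
        rw [sum_filter_of_ne]
        intro m _ hm
        by_contra h
        exact hm (hfz m (fun h1 => h (Or.inl h1)) (fun h2 => h (Or.inr h2)))
    _ ≤ ∑ m' ∈ ({1, 2} : Finset ℕ), f m' := sum_le_sum_of_subset_of_nonneg hsub fun m _ _ => hf0 m
    _ = (exp 2 * (κ + ρ)) ^ 2 * N 1 + (exp 2 * (κ + ρ)) ^ 4 * N 2 := by
        rw [sum_pair (by norm_num)]

/-! ## §2 The base datum on shapes -/

/-- **THE BASE DATUM ON SHAPES.**  With `κ = κ₀ > 0`, `ρ = ρ₀ > 0`, `αw = a₀·(M/β)`, `crw = r₀·(M/β)`, `ccw = w₀·(M/β)` (`a₀, r₀, w₀ > 0`), a field-weighted norm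
`0 ≤ nV ≤ (e²(κ+ρ))²·(|β|/(4M))·F + (e²(κ+ρ))⁴·(|U|·|β|/(4M))` with frame weight `F ≤ f₀·U` and `0 < U ≤ 1/(2θ₁+1)`,
`θ₁ = (e·a₀/(4κ₀²))·((e²(κ₀+ρ₀))²f₀ + (e²(κ₀+ρ₀))⁴)`, the assembly's `cF cg Ag Pg` binders give: `e·αw·nV/κ² ≤ 1/2`, `cg = g₀`, `Ag = A₀·(β/M)`,
`P₀·(M/β)² ≤ Pg ≤ 2P₀·(M/β)²`. [cite: BenfattoGiulianiMastropietro2006, §2.8 (2.77)-(2.80)] -/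
theorem levNum_base_reduce {β U κ ρ αw crw ccw nV cF cg Ag Pg F κ₀ ρ₀ a₀ r₀ w₀ f₀ θ₁ g₀ A₀ P₀ : ℝ} {M : ℕ} [NeZero M]
    (hβ : 0 < β) (hκ₀ : 0 < κ₀) (hρ₀ : 0 < ρ₀) (ha₀ : 0 < a₀) (hr₀ : 0 < r₀) (hw₀ : 0 < w₀) (hf₀ : 0 ≤ f₀)
    (hθ₁ : θ₁ = exp 1 * a₀ / (4 * κ₀ ^ 2) * ((exp 2 * (κ₀ + ρ₀)) ^ 2 * f₀ + (exp 2 * (κ₀ + ρ₀)) ^ 4))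
    (hg₀ : g₀ = exp 1 * a₀ * (exp 2 * (κ₀ + ρ₀)) ^ 4 / (4 * κ₀ ^ 2)) (hA₀ : A₀ = exp 1 * r₀ * (exp 2 * (κ₀ + ρ₀)) ^ 4 / (4 * w₀ * g₀ ^ 2))
    (hP₀ : P₀ = w₀ ^ 2 * g₀ / ρ₀ ^ 2)
    (hU : 0 < U) (hUθ : U ≤ 1 / (2 * θ₁ + 1)) (hF : F ≤ f₀ * U)
    (hκ : κ = κ₀) (hρ : ρ = ρ₀) (hαw : αw = a₀ * ((M : ℝ) / β)) (hcrw : crw = r₀ * ((M : ℝ) / β)) (hccw : ccw = w₀ * ((M : ℝ) / β))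
    (hnV0 : 0 ≤ nV) (hnV : nV ≤ (exp 2 * (κ + ρ)) ^ 2 * (|β| / (2 * (2 * M) : ℕ) * F) + (exp 2 * (κ + ρ)) ^ 4 * (|U| * |β| / (2 * (2 * M) : ℕ)))
    (hcF : cF = (exp 2 * (κ + ρ)) ^ (2 * 2) * (|β| / (2 * (2 * M) : ℕ))) (hcg : cg = exp 1 * αw * cF / κ ^ 2)
    (hAg : Ag = crw * exp 1 * cF / (ccw * cg ^ 2)) (hPg : Pg = ccw ^ 2 * cg / (ρ ^ 2 * (1 - exp 1 * αw * nV / κ ^ 2))) :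
    exp 1 * αw * nV / κ ^ 2 ≤ 1 / 2 ∧ cg = g₀ ∧ Ag = A₀ * (β / M) ∧ P₀ * ((M : ℝ) / β) ^ 2 ≤ Pg ∧ Pg ≤ 2 * P₀ * ((M : ℝ) / β) ^ 2 := by
  have hM : (0 : ℝ) < M := Nat.cast_pos.2 (Nat.pos_of_ne_zero (NeZero.ne M))
  have hcast : ((2 * (2 * M) : ℕ) : ℝ) = 4 * M := by push_cast; ring
  have hβabs : |β| = β := abs_of_pos hβ
  have hUabs : |U| = U := abs_of_pos hU
  subst κ ρ
  rw [hcast, hβabs, hUabs] at hnV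
  rw [hcast, hβabs] at hcF
  have hc0 : 0 < exp 2 * (κ₀ + ρ₀) := by positivity
  have hg₀0 : 0 < g₀ := by rw [hg₀]; positivity
  -- θ
  have hθ₁0 : 0 ≤ θ₁ := by rw [hθ₁]; positivity
  have hθ : exp 1 * αw * nV / κ₀ ^ 2 ≤ 1 / 2 := by
    have h1 : exp 1 * αw * nV / κ₀ ^ 2 ≤ θ₁ * U := by
      rw [hαw, hθ₁, div_le_iff₀ (by positivity)]
      have hnV' : nV ≤ (exp 2 * (κ₀ + ρ₀)) ^ 2 * (β / (4 * M) * (f₀ * U)) + (exp 2 * (κ₀ + ρ₀)) ^ 4 * (U * β / (4 * M)) :=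
        hnV.trans (by gcongr)
      calc exp 1 * (a₀ * ((M : ℝ) / β)) * nV ≤ exp 1 * (a₀ * ((M : ℝ) / β)) *
            ((exp 2 * (κ₀ + ρ₀)) ^ 2 * (β / (4 * M) * (f₀ * U)) + (exp 2 * (κ₀ + ρ₀)) ^ 4 * (U * β / (4 * M))) := by gcongr
        _ = exp 1 * a₀ / (4 * κ₀ ^ 2) * ((exp 2 * (κ₀ + ρ₀)) ^ 2 * f₀ + (exp 2 * (κ₀ + ρ₀)) ^ 4) * U * κ₀ ^ 2 := by
            field_simp
    have h2 : θ₁ * U ≤ 1 / 2 := by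
      calc θ₁ * U ≤ θ₁ * (1 / (2 * θ₁ + 1)) := by gcongr
        _ ≤ 1 / 2 := by rw [mul_one_div, div_le_iff₀ (by positivity)]; linarith
    exact h1.trans h2
  have hθ0 : 0 ≤ exp 1 * αw * nV / κ₀ ^ 2 := by rw [hαw]; positivity
  -- cg, Ag
  have hcg' : cg = g₀ := by rw [hcg, hcF, hαw, hg₀]; field_simp; ring
  have hAg' : Ag = A₀ * (β / M) := by
    rw [hAg, hcrw, hccw, hcg', hcF, hA₀]; field_simp; ring
  -- Pg two-sided
  have hden₁ : (1 : ℝ) / 2 ≤ 1 - exp 1 * αw * nV / κ₀ ^ 2 := by linarith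
  have hden₂ : 1 - exp 1 * αw * nV / κ₀ ^ 2 ≤ 1 := by linarith
  have hPg' : Pg = P₀ * ((M : ℝ) / β) ^ 2 / (1 - exp 1 * αw * nV / κ₀ ^ 2) := by
    rw [hPg, hccw, hcg', hP₀]; field_simp
  have hP₀0 : 0 < P₀ * ((M : ℝ) / β) ^ 2 := by rw [hP₀]; positivity
  refine ⟨hθ, hcg', hAg', ?_, ?_⟩
  · rw [hPg']; exact le_div_self hP₀0.le (by linarith) hden₂
  · rw [hPg', div_le_iff₀ (by linarith)]
    have h := mul_le_mul_of_nonneg_left hden₁ hP₀0.le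
    linarith

end Summit.HubbardSuperconductivity.HubbardSuperconductivity.Theorems.EngineV8

end
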